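import Literature.Geometry.Lorentzian.TeukolskyWhitingFarField
import Literature.Geometry.Lorentzian.ErdelyiEndpoint
import HarnessLib

/-!
# Whiting's transform on the real axis: the equation, the bounds, and injectivity at the
# horizon (Teixeira da Costa 2020, Prop. 3.8 (2)–(4), Lemmas 3.12, 3.14, 3.15)

Part of the proof programme for the named fact
`Literature.Geometry.Lorentzian.Kerr.Costa2019_realAxisModeStability` (R. Teixeira da Costa,
Commun. Math. Phys. 378 (2020) 705–781 = arXiv:1910.02854 [Costa2019], Thm. 4.1). For a classical
radial solution `R` (`s ≤ 0`, `2s ∈ ℤ`, real `ω ≠ 0`) outgoing at `𝓗⁺` and `𝓘⁺`, this file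
constructs the real-axis values `G₀, G₁, G₂` of the Whiting transform of the amplitude
`Φ = (r−r₋)^η (r−r₊)^ξ e^{−iωr} R` and of its first two `x`-derivatives
(`Costa2019.realAxis_transform`) and proves exactly the inputs of the end-game
(`Costa2019.tildeSolution_eq_zero`): the tilde equation `Δ_x G₂ + P̃ G₁ + Q̃ G₀ = 0` on
`(r₊, ∞)` (Lemma 3.12 at `y = 0`, obtained from `yω > 0` by continuity in `y`), boundedness near
`x = r₊`, the decay `|G₀|, |G₁| ≲ x^{s−1}`, `|G₁ − 2iωG₀| ≲ x^{s−2}` (Lemmas 3.14–3.15: Erdélyi's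
lemma at the endpoint `r = r₊` for the near part, `n` integrations by parts for the far part),
and the injectivity link (Prop. 3.8 (4), Lemma 3.14): if `G₀ ≡ 0` then the horizon coefficient
`b₀ = [(r−r₊)^{s−ξ}R](r₊)` vanishes (Erdélyi's lower bound), i.e. `R (r−r₊)^{s−ξ} → 0` at `r₊`.
The amplitude is split by a smooth cutoff `χ` (equal to `1` near `r₊`, built from
`Real.smoothTransition` in the variable `1/r` so that `1 − χ` is a symbol) into a compactly
supported near part (absolutely convergent for every `z`) and a far part handled by
`Costa2019.far_package`. Everything is proved; theorems only (D-0026).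

## References
* R. Teixeira da Costa, CMP 378 (2020) 705–781, arXiv:1910.02854, Prop. 3.8, Lemmas 3.10–3.15.
  [Costa2019]
-/

noncomputable section

open Complex Set MeasureTheory Filter Topology

namespace Literature.Geometry.Lorentzian.Kerr

namespace Costa2019

/-! ### A limit principle: values at `y = 0` from the side `ωy > 0` -/

/-- If `g` is continuous at `0` within `{ωy ≥ 0}` and vanishes for `ωy > 0`, then `g(0) = 0`.
[folklore] -/
theorem eq_zero_of_continuousWithinAt_side {g : ℝ → ℂ} {ω : ℝ} (hω : ω ≠ 0)
    (hg : ContinuousWithinAt g {y | 0 ≤ ω * y} 0) (h : ∀ y, 0 < ω * y → g y = 0) : g 0 = 0 := by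
  have hsub : {y : ℝ | 0 < ω * y} ⊆ {y | 0 ≤ ω * y} := fun y (hy : 0 < ω * y) =>
    (le_of_lt hy : 0 ≤ ω * y)
  have h1 : Tendsto g (𝓝[{y | 0 < ω * y}] 0) (𝓝 (g 0)) :=
    hg.tendsto.mono_left (nhdsWithin_mono _ hsub)
  have h2 : Tendsto g (𝓝[{y | 0 < ω * y}] 0) (𝓝 0) :=
    tendsto_const_nhds.congr' (eventually_nhdsWithin_of_forall fun y hy => (h y hy).symm)
  haveI : (𝓝[{y : ℝ | 0 < ω * y}] 0).NeBot := by
    rcases lt_or_gt_of_ne hω with hω' | hω'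
    · have : {y : ℝ | 0 < ω * y} = Iio 0 := by
        ext y
        simp only [mem_setOf_eq, mem_Iio]
        constructor
        · intro hy; nlinarith
        · intro hy; nlinarith
      rw [this]; infer_instance
    · have : {y : ℝ | 0 < ω * y} = Ioi 0 := by
        ext y
        simp only [mem_setOf_eq, mem_Ioi]
        constructor
        · intro hy; nlinarith
        · intro hy; nlinarith
      rw [this]; infer_instance
  exact tendsto_nhds_unique h1 h2

/-! ### Translation of half-line integrals; gluing of smooth functions; powers of symbols -/

/-- `∫_{(a,∞)} f = ∫_{(0,∞)} f(a + t) dt`. [folklore] -/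
theorem setIntegral_Ioi_eq_comp_add (f : ℝ → ℂ) (a : ℝ) :
    ∫ r in Ioi a, f r = ∫ t in Ioi (0 : ℝ), f (a + t) := by
  rw [← integral_indicator measurableSet_Ioi, ← integral_indicator measurableSet_Ioi,
    ← integral_add_right_eq_self (μ := volume) (fun r => (Ioi a).indicator f r) a]
  refine integral_congr_ae (ae_of_all _ fun t => ?_)
  simp only [Set.indicator_apply, mem_Ioi]
  by_cases h : 0 < t
  · rw [if_pos (by linarith), if_pos h, add_comm]
  · rw [if_neg (by linarith), if_neg h]

/-- **Gluing.** A function smooth on `(−ε, ε)` which vanishes on `[T, ∞)` and on `(−∞, −τ]` with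
`T, τ < ε` is smooth on `ℝ`. [folklore] -/
theorem contDiff_of_local {h : ℝ → ℂ} {ε T τ : ℝ} (hT : T < ε) (hτ : τ < ε)
    (hs : ContDiffOn ℝ ((⊤ : ℕ∞) : WithTop ℕ∞) h (Ioo (-ε) ε))
    (h1 : ∀ t, T ≤ t → h t = 0) (h2 : ∀ t, t ≤ -τ → h t = 0) :
    ContDiff ℝ ((⊤ : ℕ∞) : WithTop ℕ∞) h := by
  refine contDiff_iff_contDiffAt.2 fun t₀ => ?_
  by_cases ht : t₀ ∈ Ioo (-ε) ε
  · exact hs.contDiffAt (isOpen_Ioo.mem_nhds ht)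
  · rcases le_or_gt ε t₀ with hge | hlt
    · have hloc : h =ᶠ[𝓝 t₀] fun _ => (0 : ℂ) := by
        filter_upwards [Ioi_mem_nhds (hT.trans_le hge)] with t ht' using h1 t (le_of_lt ht')
      exact (contDiffAt_const (c := (0 : ℂ))).congr_of_eventuallyEq hloc
    · have hle : t₀ ≤ -ε := by
        by_contra hcon
        exact ht ⟨lt_of_not_ge hcon, hlt⟩
      have hloc : h =ᶠ[𝓝 t₀] fun _ => (0 : ℂ) := by
        filter_upwards [Iio_mem_nhds (show t₀ < -τ by linarith)] with t ht' using h2 t (le_of_lt ht')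
      exact (contDiffAt_const (c := (0 : ℂ))).congr_of_eventuallyEq hloc

/-- Powers of a symbol. [folklore] -/
theorem IsInvSmooth.pow {r₁ : ℝ} {d : ℤ} {g : ℝ → ℂ} (hr₁ : 0 < r₁) (h : IsInvSmooth r₁ d g)
    (j : ℕ) : IsInvSmooth r₁ (j * d) (fun r => g r ^ j) := by
  induction j with
  | zero => exact ((IsInvSmooth.const r₁ 1).cast_degree (by simp)).congr fun r _ => by simp
  | succ j ih =>
    refine ((ih.mul hr₁ h).cast_degree (by push_cast; ring)).congr fun r _ => ?_
    rw [pow_succ]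

/-! ### The cutoff in the variable `1/r` -/

/-- **A smooth cutoff which is a symbol.** For `0 < p < q` let
`ρ(r) = smoothTransition((1/p − 1/r)/(1/p − 1/q))`: then `ρ = 0` on `(0, p]`, `ρ = 1` on
`[q, ∞)`, `0 ≤ ρ ≤ 1`, `ρ` is smooth on `(0, ∞)`, and `ρ` is a symbol of degree `0` beyond any
`r₀ > 0` (it is a smooth function of `1/r`). [folklore] -/
theorem cutoff_facts {p q : ℝ} (hp : 0 < p) (hpq : p < q) :
    (∀ r, 0 < r → r ≤ p → Real.smoothTransition ((p⁻¹ - r⁻¹) / (p⁻¹ - q⁻¹)) = 0) ∧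
    (∀ r, q ≤ r → Real.smoothTransition ((p⁻¹ - r⁻¹) / (p⁻¹ - q⁻¹)) = 1) ∧
    ContDiffOn ℝ ((⊤ : ℕ∞) : WithTop ℕ∞)
      (fun r : ℝ => Real.smoothTransition ((p⁻¹ - r⁻¹) / (p⁻¹ - q⁻¹))) (Ioi 0) ∧
    (∀ r₀, 0 < r₀ → IsInvSmooth r₀ 0
      (fun r : ℝ => ((Real.smoothTransition ((p⁻¹ - r⁻¹) / (p⁻¹ - q⁻¹)) : ℝ) : ℂ))) := by
  have hq : 0 < q := hp.trans hpq
  have hden : 0 < p⁻¹ - q⁻¹ := sub_pos.2 ((inv_lt_inv₀ hq hp).2 hpq)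
  have hG : ContDiff ℝ ((⊤ : ℕ∞) : WithTop ℕ∞)
      (fun u : ℝ => Real.smoothTransition ((p⁻¹ - u) / (p⁻¹ - q⁻¹))) :=
    Real.smoothTransition.contDiff.comp ((contDiff_const.sub contDiff_id).div_const _)
  refine ⟨fun r hr hrp => ?_, fun r hr => ?_, ?_, fun r₀ hr₀ => ?_⟩
  · refine Real.smoothTransition.zero_of_nonpos (div_nonpos_of_nonpos_of_nonneg ?_ hden.le)
    have : p⁻¹ ≤ r⁻¹ := (inv_le_inv₀ hp hr).2 hrp
    linarith
  · have hr0 : 0 < r := hq.trans_le hr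
    refine Real.smoothTransition.one_of_one_le ?_
    rw [le_div_iff₀ hden, one_mul]
    have : r⁻¹ ≤ q⁻¹ := (inv_le_inv₀ hr0 hq).2 hr
    linarith
  · exact hG.comp_contDiffOn (contDiffOn_inv ℝ |>.mono fun r hr => ne_of_gt hr)
  · exact IsInvSmooth.of_comp_inv ((Complex.ofRealCLM.contDiff.comp hG).contDiffOn)

/-! ### Near amplitudes: absolutely convergent transforms for every `z` -/

/-- Integrability of a compactly supported bounded amplitude against any continuous factor.
[folklore] -/
theorem nearAmp_integrableOn {b ε Cg : ℝ} {g φ : ℝ → ℂ} (hε : 0 < ε)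
    (hgc : ContinuousOn g (Ioi b)) (hgb : ∀ r, b < r → ‖g r‖ ≤ Cg) (hgz : ∀ r, b + ε ≤ r → g r = 0)
    (hφ : Continuous φ) : IntegrableOn (fun r => φ r * g r) (Ioi b) := by
  obtain ⟨B, hB⟩ := (isCompact_Icc (a := b) (b := b + ε)).exists_bound_of_continuousOn
    hφ.continuousOn
  have h1 : IntegrableOn (fun r => φ r * g r) (Ioc b (b + ε)) := by
    have hc : IntegrableOn (fun _ : ℝ => (B * |Cg| : ℝ)) (Ioc b (b + ε)) :=
      integrableOn_const measure_Ioc_lt_top.ne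
    refine Integrable.mono' hc ?_ ?_
    · exact ((hφ.continuousOn.mul (hgc.mono Ioc_subset_Ioi_self)).aestronglyMeasurable
        measurableSet_Ioc)
    · refine ae_restrict_of_forall_mem measurableSet_Ioc fun r hr => ?_
      rw [norm_mul]
      exact mul_le_mul (hB r ⟨hr.1.le, hr.2⟩) ((hgb r hr.1).trans (le_abs_self _)) (norm_nonneg _)
        ((norm_nonneg _).trans (hB r ⟨hr.1.le, hr.2⟩))
  have h2 : IntegrableOn (fun r => φ r * g r) (Ioi (b + ε)) :=
    integrableOn_zero.congr_fun (fun r hr => by rw [hgz r (le_of_lt hr), mul_zero]) measurableSet_Ioi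
  rw [← Ioc_union_Ioi_eq_Ioi (show b ≤ b + ε by linarith)]
  exact h1.union h2

/-- The kernel as a function of `y` is continuous; its modulus on `(r₊, r₊ + ε)` for `|y| ≤ Y`
is at most `exp(2|ω| Y (r₊ + ε)/(r₊ − r₋))`. [cite: Costa2019, §3.2.1] -/
theorem norm_whitingKernel_le_exp {M a : ℝ} (ha : |a| < M) (ω x : ℝ) {y Y ε r : ℝ}
    (hy : |y| ≤ Y) (hr : rMinus M a ≤ r) (hr' : r ≤ rPlus M a + ε) (hM : 0 ≤ rMinus M a) :
    ‖whitingKernel M a ω ((x : ℂ) + I * y) r‖ ≤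
      Real.exp (2 * |ω| * Y * (rPlus M a + ε) / (rPlus M a - rMinus M a)) := by
  have hgap : 0 < rPlus M a - rMinus M a := sub_pos.2 (IsSubextremal.rMinus_lt_rPlus ha)
  rw [norm_whitingKernel ha]
  refine Real.exp_le_exp.2 ?_
  have h1 : -(2 * ω * y / (rPlus M a - rMinus M a)) * (r - rMinus M a) ≤
      |2 * ω * y / (rPlus M a - rMinus M a)| * (r - rMinus M a) := by
    have := neg_abs_le (2 * ω * y / (rPlus M a - rMinus M a))
    nlinarith [sub_nonneg.2 hr]
  have h2 : |2 * ω * y / (rPlus M a - rMinus M a)| = 2 * |ω| * |y| / (rPlus M a - rMinus M a) := by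
    rw [abs_div, abs_of_pos hgap, abs_mul, abs_mul, abs_two]
  rw [h2] at h1
  have h3 : r - rMinus M a ≤ rPlus M a + ε := by linarith
  have hY : 0 ≤ Y := (abs_nonneg y).trans hy
  calc _ ≤ 2 * |ω| * |y| / (rPlus M a - rMinus M a) * (r - rMinus M a) := h1
    _ ≤ 2 * |ω| * Y / (rPlus M a - rMinus M a) * (rPlus M a + ε) := by
        refine mul_le_mul ?_ h3 (sub_nonneg.2 hr) (by positivity)
        exact div_le_div_of_nonneg_right (by nlinarith [abs_nonneg ω]) hgap.le
    _ = _ := by ring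

/-- **Continuity in `y`** of the transform of a compactly supported bounded amplitude (dominated
convergence). [cite: Costa2019, Lemma 3.12 (continuity down to `y = 0`)] -/
theorem nearAmp_continuous_y {M a : ℝ} (hM : 0 < M) (ha : |a| < M) (ω : ℝ) {g : ℝ → ℂ}
    {Cg ε : ℝ} (hε : 0 < ε) (hgc : ContinuousOn g (Ioi (rPlus M a)))
    (hgb : ∀ r, rPlus M a < r → ‖g r‖ ≤ Cg) (hgz : ∀ r, rPlus M a + ε ≤ r → g r = 0) (x : ℝ) :
    Continuous fun y : ℝ => whitingTransform M a ω g ((x : ℂ) + I * y) := by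
  have hrm : 0 ≤ rMinus M a := IsSubextremal.rMinus_nonneg ha
  have _ := hM
  refine continuous_iff_continuousAt.2 fun y₀ => ?_
  unfold whitingTransform
  set B : ℝ := Real.exp (2 * |ω| * (|y₀| + 1) * (rPlus M a + ε) / (rPlus M a - rMinus M a)) with hB
  have hint : IntegrableOn g (Ioi (rPlus M a)) := by
    simpa using nearAmp_integrableOn (φ := fun _ => (1 : ℂ)) hε hgc hgb hgz continuous_const
  refine continuousAt_of_dominated (bound := fun r => B * ‖g r‖) ?_ ?_ ?_ ?_
  · exact Eventually.of_forall fun y =>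
      ((continuous_whitingKernel_r M a ω _).continuousOn.mul hgc).aestronglyMeasurable
        measurableSet_Ioi
  · filter_upwards [Metric.ball_mem_nhds y₀ one_pos] with y hy
    refine ae_restrict_of_forall_mem measurableSet_Ioi fun r hr => ?_
    rw [norm_mul]
    rcases lt_or_ge r (rPlus M a + ε) with h | h
    · refine mul_le_mul_of_nonneg_right ?_ (norm_nonneg _)
      have hyY : |y| ≤ |y₀| + 1 := by
        have : |y - y₀| < 1 := by simpa [Real.dist_eq] using hy
        have := abs_sub_abs_le_abs_sub y y₀
        linarith
      exact norm_whitingKernel_le_exp ha ω x hyY ((rMinus_le_rPlus M a).trans (le_of_lt hr))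
        h.le hrm
    · rw [hgz r h, norm_zero, mul_zero, mul_zero]
  · exact (hint.norm.const_mul B)
  · refine ae_of_all _ fun r => ?_
    have : Continuous fun y : ℝ => whitingKernel M a ω ((x : ℂ) + I * y) r := by
      unfold whitingKernel
      exact Complex.continuous_exp.comp ((continuous_const.mul ((continuous_const.add
        (continuous_const.mul Complex.continuous_ofReal)).sub continuous_const)).mul
          continuous_const)
    exact (this.mul continuous_const).continuousAt

/-- **Differentiation in `x` under the integral sign** for a compactly supported bounded
amplitude, any `y`: `∂ₓ ∫ K g = ∫ K A(r−r₋) g`. [cite: Costa2019, Lemma 3.12] -/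
theorem nearAmp_hasDerivAt_x {M a : ℝ} (hM : 0 < M) (ha : |a| < M) (ω : ℝ) {g : ℝ → ℂ}
    {Cg ε : ℝ} (hε : 0 < ε) (hgc : ContinuousOn g (Ioi (rPlus M a)))
    (hgb : ∀ r, rPlus M a < r → ‖g r‖ ≤ Cg) (hgz : ∀ r, rPlus M a + ε ≤ r → g r = 0) (y x : ℝ) :
    HasDerivAt (fun x : ℝ => whitingTransform M a ω g ((x : ℂ) + I * y))
      (whitingTransform M a ω (fun r => whitingA M a ω * ((r - rMinus M a : ℝ) : ℂ) * g r)
        ((x : ℂ) + I * y)) x := by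
  have hrm : 0 ≤ rMinus M a := IsSubextremal.rMinus_nonneg ha
  have hrp : 0 < rPlus M a := rPlus_pos hM a
  set B : ℝ := Real.exp (2 * |ω| * |y| * (rPlus M a + ε) / (rPlus M a - rMinus M a)) *
    (‖whitingA M a ω‖ * (rPlus M a + ε)) with hB
  have hint : IntegrableOn g (Ioi (rPlus M a)) := by
    simpa using nearAmp_integrableOn (φ := fun _ => (1 : ℂ)) hε hgc hgb hgz continuous_const
  have hcA : Continuous fun r : ℝ => whitingA M a ω * ((r - rMinus M a : ℝ) : ℂ) :=
    continuous_const.mul (Complex.continuous_ofReal.comp (continuous_id.sub continuous_const))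
  have h := hasDerivAt_setIntegral_mul (κ := fun x r => whitingKernel M a ω ((x : ℂ) + I * y) r)
    (κ' := fun x r => whitingKernel M a ω ((x : ℂ) + I * y) r *
      (whitingA M a ω * ((r - rMinus M a : ℝ) : ℂ)))
    (Φ := g) (x₀ := x) measurableSet_Ioi (bound := fun r => B * ‖g r‖)
    (fun x => (continuous_whitingKernel_r M a ω _).continuousOn)
    ((continuous_whitingKernel_r M a ω _).mul hcA).continuousOn hgc
    (nearAmp_integrableOn hε hgc hgb hgz (continuous_whitingKernel_r M a ω _))
    (fun r hr x' => by
      rw [norm_mul]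
      rcases lt_or_ge r (rPlus M a + ε) with h | h
      · refine mul_le_mul_of_nonneg_right ?_ (norm_nonneg _)
        rw [norm_mul]
        have hr' : rPlus M a < r := hr
        have hK := norm_whitingKernel_le_exp ha ω x' (le_refl |y|)
          ((rMinus_le_rPlus M a).trans hr'.le) h.le hrm
        have hA : ‖whitingA M a ω * ((r - rMinus M a : ℝ) : ℂ)‖ ≤ ‖whitingA M a ω‖ * (rPlus M a + ε) := by
          rw [norm_mul, Complex.norm_real, Real.norm_eq_abs,
            abs_of_nonneg (by linarith [rMinus_le_rPlus M a])]
          exact mul_le_mul_of_nonneg_left (by linarith) (norm_nonneg _)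
        exact mul_le_mul hK hA (norm_nonneg _) (Real.exp_pos _).le
      · rw [hgz r h, norm_zero, mul_zero, mul_zero])
    (hint.norm.const_mul B)
    (fun r _ x' => hasDerivAt_whitingKernel_x M a ω y r x')
  have heq : (∫ r in Ioi (rPlus M a), whitingKernel M a ω ((x : ℂ) + I * y) r *
      (whitingA M a ω * ((r - rMinus M a : ℝ) : ℂ)) * g r) =
      whitingTransform M a ω (fun r => whitingA M a ω * ((r - rMinus M a : ℝ) : ℂ) * g r)
        ((x : ℂ) + I * y) := by
    unfold whitingTransform
    refine integral_congr_ae (ae_of_all _ fun r => ?_)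
    ring
  rw [← heq]
  exact h.2

/-- **Size on the real axis**: `|K| = 1` at `y = 0`, so `‖∫ K g‖ ≤ Cg · ε`. [cite: Costa2019, Lemma 3.15] -/
theorem nearAmp_norm_le {M a : ℝ} (ha : |a| < M) (ω : ℝ) {g : ℝ → ℂ}
    {Cg ε : ℝ} (hε : 0 < ε)
    (hgb : ∀ r, rPlus M a < r → ‖g r‖ ≤ Cg) (hgz : ∀ r, rPlus M a + ε ≤ r → g r = 0) (x : ℝ) :
    ‖whitingTransform M a ω g ((x : ℂ) + I * ((0 : ℝ) : ℂ))‖ ≤ Cg * ε := by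
  unfold whitingTransform
  have h1 : (∫ r in Ioi (rPlus M a), whitingKernel M a ω ((x : ℂ) + I * ((0 : ℝ) : ℂ)) r * g r) =
      ∫ r in Ioc (rPlus M a) (rPlus M a + ε), whitingKernel M a ω ((x : ℂ) + I * ((0 : ℝ) : ℂ)) r * g r := by
    refine setIntegral_eq_of_subset_of_forall_sdiff_eq_zero measurableSet_Ioi
      Ioc_subset_Ioi_self fun r hr => ?_
    have h2 : rPlus M a + ε < r := lt_of_not_ge fun hle => hr.2 ⟨hr.1, hle⟩
    rw [hgz r h2.le, mul_zero]
  rw [h1]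
  have h2 : ∀ r ∈ Ioc (rPlus M a) (rPlus M a + ε),
      ‖whitingKernel M a ω ((x : ℂ) + I * ((0 : ℝ) : ℂ)) r * g r‖ ≤ Cg := by
    intro r hr
    rw [norm_mul, norm_whitingKernel ha]
    simp only [mul_zero, zero_div, neg_zero, zero_mul, Real.exp_zero, one_mul]
    exact hgb r hr.1
  calc _ ≤ Cg * (volume (Ioc (rPlus M a) (rPlus M a + ε))).toReal :=
        norm_setIntegral_le_of_norm_le_const measure_Ioc_lt_top h2
    _ = Cg * ε := by
        rw [Real.volume_Ioc, ENNReal.toReal_ofReal (by linarith)]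
        ring

/-- **The near integral on the real axis as an oscillatory integral at the endpoint.** If
`g(r₊ + t) = t^β h(t)` for `t > 0`, then with `ν = 2ω(x − r₋)/(r₊ − r₋)`:
`∫_{r₊}^∞ e^{A(x−r₋)(r−r₋)} g = e^{iν(r₊−r₋)} ∫₀^∞ e^{iνt} t^β h(t) dt`.
[cite: Costa2019, Lemma 3.14, Lemma 3.15 (Erdélyi)] -/
theorem nearAmp_repr_realAxis {M a : ℝ} (ha : |a| < M) (ω : ℝ) {g : ℝ → ℂ} {β : ℂ} {h : ℝ → ℂ}
    (hrepr : ∀ t, 0 < t → g (rPlus M a + t) = (t : ℂ) ^ β * h t) (x : ℝ) :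
    whitingTransform M a ω g ((x : ℂ) + I * ((0 : ℝ) : ℂ)) =
      Complex.exp (I * ((2 * ω * (x - rMinus M a) / (rPlus M a - rMinus M a) : ℝ) : ℂ) *
          ((rPlus M a - rMinus M a : ℝ) : ℂ)) *
        ∫ t in Ioi (0 : ℝ), Complex.exp (I * ((2 * ω * (x - rMinus M a) /
          (rPlus M a - rMinus M a) : ℝ) : ℂ) * t) * (t : ℂ) ^ β * h t := by
  set ν : ℝ := 2 * ω * (x - rMinus M a) / (rPlus M a - rMinus M a) with hν
  -- the exponent at `y = 0` is `iν`
  have hlam : whitingA M a ω * (((x : ℂ) + I * ((0 : ℝ) : ℂ)) - rMinus M a) = I * ν := by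
    obtain ⟨hre, him⟩ := whitingA_mul_re_im ha ω x 0
    apply Complex.ext
    · rw [hre, Complex.mul_re, Complex.I_re, Complex.I_im, Complex.ofReal_re, Complex.ofReal_im]
      ring
    · rw [him, Complex.mul_im, Complex.I_re, Complex.I_im, Complex.ofReal_re, Complex.ofReal_im,
        hν]
      ring
  have hK : ∀ r, whitingKernel M a ω ((x : ℂ) + I * ((0 : ℝ) : ℂ)) r =
      Complex.exp (I * ν * ((r - rMinus M a : ℝ) : ℂ)) := by
    intro r; unfold whitingKernel; rw [hlam]
  unfold whitingTransform
  simp_rw [hK]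
  rw [setIntegral_Ioi_eq_comp_add _ (rPlus M a), ← integral_const_mul]
  refine setIntegral_congr_fun measurableSet_Ioi fun t ht => ?_
  have ht' : 0 < t := ht
  rw [hrepr t ht', show ((rPlus M a + t - rMinus M a : ℝ) : ℂ) =
    ((rPlus M a - rMinus M a : ℝ) : ℂ) + (t : ℂ) by push_cast; ring, mul_add, Complex.exp_add]
  ring

/-! ### The amplitude near the horizon -/

/-- **Factorisation of the amplitude at the horizon.** For `R` outgoing at `𝓗⁺` there are
`ε > 0` (with `ε < r₊ − r₋`, `ε < r₊`) and `f` smooth on `(r₊ − 2ε, r₊ + 2ε)` with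
`R (r−r₊)^{s−ξ} = f` and `Φ = (r − r₊)^{2ξ−s} · [(r−r₋)^η e^{−iωr} f(r)]` on `(r₊, r₊ + 2ε)`
(`Φ` the Whiting amplitude): the integrand of `g̃` is `(r − r₊)^{2ξ−s}` times a function smooth
across `r₊` (TdC §3.2.1: "the integrand … is `O((r−r₊)^{−s})` as `r → r₊`"; Lemma 3.14).
[cite: Costa2019, Def. 2.4, §3.2.1, Lemma 3.14] -/
theorem horizon_amplitude_factorisation {M a : ℝ} (hM : 0 < M) (ha : |a| < M) {s ω m : ℝ}
    {R : ℝ → ℂ} (hH : IsOutgoingAtHorizon M a s ω m R) :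
    ∃ (ε : ℝ) (f : ℝ → ℂ), 0 < ε ∧ ε < rPlus M a - rMinus M a ∧ ε < rPlus M a ∧
      ContDiffOn ℝ ((⊤ : ℕ∞) : WithTop ℕ∞) f (Ioo (rPlus M a - 2 * ε) (rPlus M a + 2 * ε)) ∧
      (∀ r ∈ Ioo (rPlus M a) (rPlus M a + 2 * ε),
        R r * ((r - rPlus M a : ℝ) : ℂ) ^ ((s : ℂ) - horizonExponent M a ω m) = f r) ∧
      ∀ r ∈ Ioo (rPlus M a) (rPlus M a + 2 * ε),
        whitingAmplitude M a ω m R r =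
          ((r - rPlus M a : ℝ) : ℂ) ^ (2 * horizonExponent M a ω m - s) *
            (((r - rMinus M a : ℝ) : ℂ) ^ innerExponent M a ω m * Complex.exp (-(I * ω * r)) * f r) := by
  obtain ⟨ε₀, hε₀, f, hf, hRf⟩ := hH
  have hrp : 0 < rPlus M a := rPlus_pos hM a
  have hgap : 0 < rPlus M a - rMinus M a := sub_pos.2 (IsSubextremal.rMinus_lt_rPlus ha)
  set ε : ℝ := min (ε₀ / 2) (min ((rPlus M a - rMinus M a) / 2) (rPlus M a / 2)) with hε
  have hεpos : 0 < ε := lt_min (by linarith) (lt_min (by linarith) (by linarith))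
  have hε₁ : 2 * ε ≤ ε₀ := by have := min_le_left (ε₀ / 2) (min ((rPlus M a - rMinus M a) / 2) (rPlus M a / 2)); linarith
  have hε₂ : ε < rPlus M a - rMinus M a := by
    have := (min_le_right (ε₀ / 2) _).trans (min_le_left ((rPlus M a - rMinus M a) / 2) (rPlus M a / 2))
    linarith
  have hε₃ : ε < rPlus M a := by
    have := (min_le_right (ε₀ / 2) _).trans (min_le_right ((rPlus M a - rMinus M a) / 2) (rPlus M a / 2))
    linarith
  have hsub : Ioo (rPlus M a) (rPlus M a + 2 * ε) ⊆ Ioo (rPlus M a) (rPlus M a + ε₀) :=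
    Ioo_subset_Ioo le_rfl (by linarith)
  refine ⟨ε, f, hεpos, hε₂, hε₃, hf.mono (Ioo_subset_Ioo (by linarith) (by linarith)),
    fun r hr => hRf r (hsub hr), fun r hr => ?_⟩
  have hr' : rPlus M a < r := hr.1
  set u : ℂ := ((r - rPlus M a : ℝ) : ℂ) with hu
  have hu0 : u ≠ 0 := by rw [hu]; exact_mod_cast (sub_pos.2 hr').ne'
  set ξ := horizonExponent M a ω m with hξ
  have e1 : u ^ ((s : ℂ) - ξ) * u ^ (-((s : ℂ) - ξ)) = 1 := by
    rw [← Complex.cpow_add _ _ hu0, add_neg_cancel, Complex.cpow_zero]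
  have hR : R r = f r * u ^ (-((s : ℂ) - ξ)) := by
    calc R r = R r * (u ^ ((s : ℂ) - ξ) * u ^ (-((s : ℂ) - ξ))) := by rw [e1, mul_one]
      _ = (R r * u ^ ((s : ℂ) - ξ)) * u ^ (-((s : ℂ) - ξ)) := by ring
      _ = f r * u ^ (-((s : ℂ) - ξ)) := by rw [hRf r (hsub hr)]
  have e2 : u ^ ξ * u ^ (-((s : ℂ) - ξ)) = u ^ (2 * ξ - s) := by
    rw [← Complex.cpow_add _ _ hu0]; congr 1; ring
  unfold whitingAmplitude
  rw [hR]
  calc ((r - rMinus M a : ℝ) : ℂ) ^ innerExponent M a ω m * u ^ ξ * Complex.exp (-(I * ω * r)) *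
        (f r * u ^ (-((s : ℂ) - ξ))) =
      (u ^ ξ * u ^ (-((s : ℂ) - ξ))) *
        (((r - rMinus M a : ℝ) : ℂ) ^ innerExponent M a ω m * Complex.exp (-(I * ω * r)) * f r) := by
        ring
    _ = _ := by rw [e2]

/-- **The endpoint representation `χ Φ = t^β h(t)` with `h` smooth and compactly supported.**
Given the factorisation of the amplitude near `r₊` (previous lemma), a cutoff `χ` (smooth on
`(0, ∞)`, `χ(r₊) = 1`, `χ = 0` beyond `r₊ + 2ε/3`), a smooth weight `P` and an extra power
`(r − r₊)ᵉ`, the near amplitude `χ (r−r₊)ᵉ P Φ` equals `t^{β+e} h(t)` at `r = r₊ + t`, `t > 0`,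
with `h : ℝ → ℂ` smooth, vanishing on `[2ε/3, ∞)`, and
`h(0) = P(r₊) (r₊−r₋)^η e^{−iωr₊} f(r₊)`. This is the input of Erdélyi's lemma (Lemmas 3.14–3.15:
"`g̃(x) = Γ(2ξ−s+1) (−i2ω(x−r₋))^{−(2ξ−s+1)} Σ bₖ …` with `b₀ = [(r−r₊)^{s−ξ}R](r₊)`").
[cite: Costa2019, Lemma 3.14, Lemma 3.15] -/
theorem exists_endpoint_repr {M a : ℝ} (hM : 0 < M) (ha : |a| < M) (ω m : ℝ) {ε : ℝ} {f : ℝ → ℂ}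
    (hε : 0 < ε) (hεd : ε < rPlus M a - rMinus M a) (hεp : ε < rPlus M a)
    (hf : ContDiffOn ℝ ((⊤ : ℕ∞) : WithTop ℕ∞) f (Ioo (rPlus M a - 2 * ε) (rPlus M a + 2 * ε)))
    {Φ : ℝ → ℂ} {β₀ : ℂ}
    (hfac : ∀ r ∈ Ioo (rPlus M a) (rPlus M a + 2 * ε),
      Φ r = ((r - rPlus M a : ℝ) : ℂ) ^ β₀ *
        (((r - rMinus M a : ℝ) : ℂ) ^ innerExponent M a ω m * Complex.exp (-(I * ω * r)) * f r))
    {χ : ℝ → ℝ} (hχs : ContDiffOn ℝ ((⊤ : ℕ∞) : WithTop ℕ∞) χ (Ioi 0)) (hχ1 : χ (rPlus M a) = 1)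
    (hχ0 : ∀ r, rPlus M a + 2 * ε / 3 ≤ r → χ r = 0)
    {P : ℝ → ℂ} (hP : ContDiff ℝ ((⊤ : ℕ∞) : WithTop ℕ∞) P) (e : ℕ)
    {gN : ℝ → ℂ}
    (hgN : ∀ r, gN r = ((χ r : ℝ) : ℂ) * ((((r - rPlus M a : ℝ) : ℂ)) ^ e * P r * Φ r)) :
    ∃ h : ℝ → ℂ, ContDiff ℝ ((⊤ : ℕ∞) : WithTop ℕ∞) h ∧ (∀ t, 2 * ε / 3 ≤ t → h t = 0) ∧
      h 0 = P (rPlus M a) * (((rPlus M a - rMinus M a : ℝ) : ℂ) ^ innerExponent M a ω m *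
        Complex.exp (-(I * ω * rPlus M a)) * f (rPlus M a)) ∧
      ∀ t, 0 < t → gN (rPlus M a + t) = (t : ℂ) ^ (β₀ + e) * h t := by
  have hrp : 0 < rPlus M a := rPlus_pos hM a
  have hgap : 0 < rPlus M a - rMinus M a := sub_pos.2 (IsSubextremal.rMinus_lt_rPlus ha)
  -- the bump `ψ` and the smooth core `K`
  set ψ : ℝ → ℝ := fun t => Real.smoothTransition ((t + ε / 2) / (ε / 6)) with hψ
  set K : ℝ → ℂ := fun x => ((x - rMinus M a : ℝ) : ℂ) ^ innerExponent M a ω m *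
      Complex.exp (-(I * ω * x)) * f x with hK
  set h : ℝ → ℂ := fun t => ((ψ t : ℝ) : ℂ) * (((χ (rPlus M a + t) : ℝ) : ℂ) *
      (P (rPlus M a + t) * K (rPlus M a + t))) with hh
  have hψs : ContDiff ℝ ((⊤ : ℕ∞) : WithTop ℕ∞) ψ :=
    Real.smoothTransition.contDiff.comp ((contDiff_id.add contDiff_const).div_const _)
  have hψ0 : ∀ t, t ≤ -(ε / 2) → ψ t = 0 := fun t ht =>
    Real.smoothTransition.zero_of_nonpos (div_nonpos_of_nonpos_of_nonneg (by linarith) (by linarith))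
  have hψ1 : ∀ t, -(ε / 3) ≤ t → ψ t = 1 := fun t ht => by
    refine Real.smoothTransition.one_of_one_le ?_
    rw [le_div_iff₀ (by linarith), one_mul]; linarith
  -- smoothness of `K` on `(r₊ − ε, r₊ + ε)` and of `h` on `(−ε, ε)`
  have hKs : ContDiffOn ℝ ((⊤ : ℕ∞) : WithTop ℕ∞) K (Ioo (rPlus M a - ε) (rPlus M a + ε)) := by
    refine ContDiffOn.mul (ContDiffOn.mul ?_ ?_) (hf.mono (Ioo_subset_Ioo (by linarith) (by linarith)))
    · exact (contDiffOn_ofReal_sub_cpow (rMinus M a) _).mono fun x hx => by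
        simp only [mem_Ioi]; linarith [hx.1]
    · exact (Complex.contDiff_exp.comp ((contDiff_const.mul Complex.ofRealCLM.contDiff).neg)).contDiffOn
  have hτ : ContDiff ℝ ((⊤ : ℕ∞) : WithTop ℕ∞) (fun t : ℝ => rPlus M a + t) := contDiff_const.add contDiff_id
  have hmaps : MapsTo (fun t : ℝ => rPlus M a + t) (Ioo (-ε) ε) (Ioo (rPlus M a - ε) (rPlus M a + ε)) :=
    fun t ht => ⟨by linarith [ht.1], by linarith [ht.2]⟩
  have hmaps' : MapsTo (fun t : ℝ => rPlus M a + t) (Ioo (-ε) ε) (Ioi 0) :=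
    fun t ht => show (0 : ℝ) < rPlus M a + t by linarith [ht.1]
  have hhs : ContDiffOn ℝ ((⊤ : ℕ∞) : WithTop ℕ∞) h (Ioo (-ε) ε) := by
    simp only [hh]
    refine (Complex.ofRealCLM.contDiff.comp hψs).contDiffOn.mul (ContDiffOn.mul ?_ ?_)
    · exact Complex.ofRealCLM.contDiff.comp_contDiffOn (hχs.comp hτ.contDiffOn hmaps')
    · exact (hP.comp hτ).contDiffOn.mul (hKs.comp hτ.contDiffOn hmaps)
  -- support
  have hh0 : ∀ t, 2 * ε / 3 ≤ t → h t = 0 := fun t ht => by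
    simp only [hh, hχ0 (rPlus M a + t) (by linarith), Complex.ofReal_zero, zero_mul, mul_zero]
  have hh0' : ∀ t, t ≤ -(ε / 2) → h t = 0 := fun t ht => by
    simp only [hh, hψ0 t ht, Complex.ofReal_zero, zero_mul]
  have hhc : ContDiff ℝ ((⊤ : ℕ∞) : WithTop ℕ∞) h :=
    contDiff_of_local (T := 2 * ε / 3) (τ := ε / 2) (by linarith) (by linarith) hhs hh0 hh0'
  refine ⟨h, hhc, hh0, ?_, fun t ht => ?_⟩
  · simp only [hh, hK, hψ1 0 (by linarith), add_zero, hχ1, Complex.ofReal_one, one_mul]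
  · have ht0 : (t : ℂ) ≠ 0 := by exact_mod_cast ht.ne'
    rw [hgN]
    rcases lt_or_ge t (2 * ε) with hlt | hge
    · have hmem : rPlus M a + t ∈ Ioo (rPlus M a) (rPlus M a + 2 * ε) := ⟨by linarith, by linarith⟩
      rw [hfac _ hmem]
      simp only [hh, hK, hψ1 t (by linarith), Complex.ofReal_one, one_mul, add_sub_cancel_left]
      rw [Complex.cpow_add _ _ ht0, Complex.cpow_natCast]
      ring
    · have hz : χ (rPlus M a + t) = 0 := hχ0 _ (by linarith)
      simp only [hh, hz, Complex.ofReal_zero, zero_mul, mul_zero]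

/-! ### The transform on the real axis -/

/-- Continuity of the coefficients `P̃`, `Q̃` of the tilde operator (polynomials in `z`).
[folklore] -/
theorem continuous_heunPt_heunQt (M a s ω m lam : ℝ) :
    Continuous (fun z : ℂ => heunPt M a s ω m z) ∧ Continuous (fun z : ℂ => heunQt M a s ω m lam z) := by
  constructor
  · unfold heunPt
    exact ((continuous_const.mul (continuous_id.sub continuous_const)).add
      (continuous_const.mul (continuous_id.sub continuous_const))).add
      (continuous_const.mul ((continuous_id.sub continuous_const).mul (continuous_id.sub continuous_const)))
  · unfold heunQt
    exact (((continuous_const.mul (continuous_id.sub continuous_const)).add continuous_const).sub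
      continuous_const).sub continuous_const

/-- `‖e^{iνc}‖ = 1` for real `ν`, `c`. [folklore] -/
theorem norm_cexp_I_mul_ofReal_mul_ofReal (ν c : ℝ) :
    ‖Complex.exp (I * (ν : ℂ) * (c : ℂ))‖ = 1 := by
  rw [show I * (ν : ℂ) * (c : ℂ) = ((ν * c : ℝ) : ℂ) * I by push_cast; ring]
  exact Complex.norm_exp_ofReal_mul_I _

set_option maxHeartbeats 4000000 in
/-- **Whiting's transform on the real axis** (TdC Prop. 3.8 (2)–(4) for `|a| < M`, `s ≤ 0`,
`ω ∈ ℝ∖{0}`; Lemmas 3.12, 3.14, 3.15). For a classical radial solution `R` (`2s ∈ ℤ`) outgoing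
at `𝓗⁺` and `𝓘⁺` there are functions `G₀, G₁, G₂` on `(r₊, ∞)` — the values at `y = 0` of the
Whiting transform `g̃` of `Φ = (r−r₋)^η (r−r₊)^ξ e^{−iωr} R` and of `∂ₓ g̃`, `∂ₓ² g̃` — with
`G₀' = G₁`, `G₁' = G₂`, the tilde equation `Δ_x G₂ + P̃ G₁ + Q̃ G₀ = 0` (Lemma 3.12), `G₀, G₁`
bounded near `r₊`, the decay `|G₀|, |G₁| ≤ C x^{s−1}`, `|G₁ − 2iωG₀| ≤ C x^{s−2}`
(Lemmas 3.14–3.15), and the injectivity link: if `G₀ ≡ 0` then `R (r−r₊)^{s−ξ} → 0` at `r₊⁺`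
(Prop. 3.8 (4) / Lemma 3.14: the leading coefficient `Γ(2ξ−s+1)(…)b₀` must vanish).
[cite: Costa2019, Prop. 3.8, Lemma 3.12, Lemma 3.14, Lemma 3.15] -/
theorem realAxis_transform {M a : ℝ} (hM : 0 < M) (ha : |a| < M) {s : ℝ} (hs : s ≤ 0)
    {k₀ : ℤ} (hk₀ : 2 * s = k₀) {ω : ℝ} (hω : ω ≠ 0) {m lam : ℝ} {R : ℝ → ℂ}
    (hsol : IsRadialTeukolskySolution M a s ω m lam R) (hH : IsOutgoingAtHorizon M a s ω m R)
    (hI : IsOutgoingAtInfinity M s ω R) :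
    ∃ G₀ G₁ G₂ : ℝ → ℂ,
      (∀ x, rPlus M a < x → HasDerivAt G₀ (G₁ x) x) ∧
      (∀ x, rPlus M a < x → HasDerivAt G₁ (G₂ x) x) ∧
      (∀ x, rPlus M a < x →
        (delta M a x : ℂ) * G₂ x + heunPt M a s ω m x * G₁ x + heunQt M a s ω m lam x * G₀ x = 0) ∧
      (∃ δ B : ℝ, 0 < δ ∧ ∀ x ∈ Ioo (rPlus M a) (rPlus M a + δ), ‖G₀ x‖ ≤ B ∧ ‖G₁ x‖ ≤ B) ∧
      (∃ X C : ℝ, ∀ x, X ≤ x →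
        ‖G₀ x‖ ≤ C * x ^ (s - 1) ∧ ‖G₁ x‖ ≤ C * x ^ (s - 1) ∧
          ‖G₁ x - 2 * I * ω * G₀ x‖ ≤ C * x ^ (s - 2)) ∧
      ((∀ x, rPlus M a < x → G₀ x = 0) →
        Tendsto (fun r => R r * ((r - rPlus M a : ℝ) : ℂ) ^ ((s : ℂ) - horizonExponent M a ω m))
          (𝓝[>] rPlus M a) (𝓝 0)) := by
  -- constants
  have hrp : 0 < rPlus M a := rPlus_pos hM a
  have hgap : 0 < rPlus M a - rMinus M a := sub_pos.2 (IsSubextremal.rMinus_lt_rPlus ha)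
  have hrm0 : 0 ≤ rMinus M a := IsSubextremal.rMinus_nonneg ha
  obtain ⟨hA0, hAn⟩ := whitingA_ne_zero_norm ha hω
  have hAd : whitingA M a ω * ((rPlus M a - rMinus M a : ℝ) : ℂ) = 2 * I * ω := whitingA_mul_gap ha ω
  have hωpos : 0 < |ω| := abs_pos.2 hω
  -- horizon data and the amplitude
  obtain ⟨ε, f, hε, hεd, hεp, hf, hRf, hfac⟩ := horizon_amplitude_factorisation hM ha (s := s)
    (ω := ω) (m := m) hH
  have hΦc : ContinuousOn (whitingAmplitude M a ω m R) (Ioi (rPlus M a)) :=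
    continuousOn_whitingAmplitude ha.le hsol
  obtain ⟨CR, hCR⟩ := norm_le_mul_pow_of_outgoing ha hs hsol hH hI
  set kR : ℕ := ⌈-2 * s⌉₊ with hkR
  have hCR0 : 0 ≤ CR := by
    have h1 := (norm_nonneg _).trans (hCR (rPlus M a + 1) (by linarith))
    exact le_of_mul_le_mul_right (by simpa using h1) (pow_pos (by linarith) _)
  have hΦb : ∀ r, rPlus M a < r → ‖whitingAmplitude M a ω m R r‖ ≤ CR * (1 + r) ^ kR := fun r hr => by
    rw [norm_whitingAmplitude M a ω m R hr]; exact hCR r hr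
  have hPε : 0 ≤ CR * (1 + rPlus M a + ε) ^ kR := mul_nonneg hCR0 (pow_nonneg (by linarith) _)
  have hΦbε : ∀ r, rPlus M a < r → r ≤ rPlus M a + ε →
      ‖whitingAmplitude M a ω m R r‖ ≤ CR * (1 + rPlus M a + ε) ^ kR := by
    intro r hr hrε
    calc ‖whitingAmplitude M a ω m R r‖ ≤ CR * (1 + r) ^ kR := hΦb r hr
      _ ≤ CR * (1 + rPlus M a + ε) ^ kR :=
          mul_le_mul_of_nonneg_left (pow_le_pow_left₀ (by linarith) (by linarith) _) hCR0
  -- the cutoff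
  set p₁ : ℝ := rPlus M a + ε / 3 with hp₁
  set q₁ : ℝ := rPlus M a + 2 * ε / 3 with hq₁
  have hp₁0 : 0 < p₁ := by rw [hp₁]; linarith
  have hp₁q₁ : p₁ < q₁ := by rw [hp₁, hq₁]; linarith
  obtain ⟨hρ0, hρ1, hρs, hρinv⟩ := cutoff_facts hp₁0 hp₁q₁
  set ρ : ℝ → ℝ := fun r => Real.smoothTransition ((p₁⁻¹ - r⁻¹) / (p₁⁻¹ - q₁⁻¹)) with hρ
  set χ : ℝ → ℝ := fun r => 1 - ρ r with hχ
  have hχ1' : ∀ r, 0 < r → r ≤ p₁ → χ r = 1 := fun r hr hrp' => by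
    simp only [hχ, hρ, hρ0 r hr hrp', sub_zero]
  have hχ0 : ∀ r, q₁ ≤ r → χ r = 0 := fun r hr => by simp only [hχ, hρ, hρ1 r hr, sub_self]
  have hχs : ContDiffOn ℝ ((⊤ : ℕ∞) : WithTop ℕ∞) χ (Ioi 0) := contDiffOn_const.sub hρs
  have hχ1 : χ (rPlus M a) = 1 := hχ1' _ hrp (by rw [hp₁]; linarith)
  have hχabs : ∀ r, |χ r| ≤ 1 := fun r => by
    have h1 := Real.smoothTransition.nonneg ((p₁⁻¹ - r⁻¹) / (p₁⁻¹ - q₁⁻¹))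
    have h2 := Real.smoothTransition.le_one ((p₁⁻¹ - r⁻¹) / (p₁⁻¹ - q₁⁻¹))
    simp only [hχ, hρ]
    rw [abs_le]; constructor <;> linarith
  have hχρ : ∀ r, ((χ r : ℝ) : ℂ) + ((ρ r : ℝ) : ℂ) = 1 := fun r => by
    simp only [hχ]; push_cast; ring
  have hχc : ContinuousOn (fun r => ((χ r : ℝ) : ℂ)) (Ioi (rPlus M a)) :=
    Complex.continuous_ofReal.comp_continuousOn (hχs.continuousOn.mono fun r hr => hrp.trans hr)
  -- thresholds for the far package
  set r₀ : ℝ := rPlus M a + ε / 6 with hr₀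
  set r₁ : ℝ := rPlus M a + ε / 4 with hr₁
  have hr₀p : rPlus M a < r₀ := by rw [hr₀]; linarith
  have hr₀₁ : r₀ < r₁ := by rw [hr₀, hr₁]; linarith
  have hr₁p₁ : r₁ < p₁ := by rw [hr₁, hp₁]; linarith
  have h0 : 0 < r₀ := hrp.trans hr₀p
  have hρc : IsInvSmooth r₀ 0 (fun r => ((ρ r : ℝ) : ℂ)) := hρinv r₀ h0
  -- the weight `A(r − r₋)` and the multipliers
  set πw : ℝ → ℂ := fun r => whitingA M a ω * ((r - rMinus M a : ℝ) : ℂ) with hπw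
  have hπwc : IsInvSmooth r₀ 1 πw := (IsInvSmooth.ofReal_sub_const h0 (rMinus M a)).const_mul _
  have hπw_cont : Continuous πw :=
    continuous_const.mul (Complex.continuous_ofReal.comp (continuous_id.sub continuous_const))
  have hπw_cd : ContDiff ℝ ((⊤ : ℕ∞) : WithTop ℕ∞) πw :=
    contDiff_const.mul (Complex.ofRealCLM.contDiff.comp (contDiff_id.sub contDiff_const))
  have hπw_b : ∀ r, rPlus M a < r → r ≤ rPlus M a + ε → ‖πw r‖ ≤ ‖whitingA M a ω‖ * (rPlus M a + ε) := by
    intro r hr hrε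
    simp only [hπw]
    rw [norm_mul, Complex.norm_real, Real.norm_eq_abs,
      abs_of_nonneg (by linarith [rMinus_le_rPlus M a])]
    exact mul_le_mul_of_nonneg_left (by linarith) (norm_nonneg _)
  have hαj : ∀ j : ℕ, IsInvSmooth r₀ (j : ℤ) (fun r => ((ρ r : ℝ) : ℂ) * πw r ^ j) := fun j =>
    (hρc.mul h0 (hπwc.pow h0 j)).cast_degree (by simp)
  have hαj0 : ∀ j : ℕ, ∀ r, rPlus M a < r → r ≤ p₁ → ((ρ r : ℝ) : ℂ) * πw r ^ j = 0 := by
    intro j r hr hrp'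
    simp only [hρ, hρ0 r (hrp.trans hr) hrp', Complex.ofReal_zero, zero_mul]
  -- the far packages
  set n₀ : ℕ := ⌈2 - s⌉₊ with hn₀
  have hn₀s : 2 - s ≤ (n₀ : ℝ) := Nat.le_ceil _
  obtain ⟨Far₀, FarD₀, hFa₀, hFa'₀, hFy₀, hFd₀, hFx₀, CF₀, XF₀, hFdec₀⟩ :=
    far_package hM ha hs hk₀ hω hsol hI hr₀p hr₀₁ hr₁p₁ (hαj 0) (hαj0 0) n₀
  obtain ⟨Far₁, FarD₁, hFa₁, hFa'₁, hFy₁, hFd₁, hFx₁, CF₁, XF₁, hFdec₁⟩ :=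
    far_package hM ha hs hk₀ hω hsol hI hr₀p hr₀₁ hr₁p₁ (hαj 1) (hαj0 1) n₀
  obtain ⟨Far₂, FarD₂, hFa₂, -, hFy₂, -, hFx₂, -⟩ :=
    far_package hM ha hs hk₀ hω hsol hI hr₀p hr₀₁ hr₁p₁ (hαj 2) (hαj0 2) n₀
  -- near amplitudes
  set gNf : ℕ → ℝ → ℂ := fun j r => ((χ r : ℝ) : ℂ) * (πw r ^ j * whitingAmplitude M a ω m R r) with hgNf
  set gN₃ : ℝ → ℂ := fun r => ((χ r : ℝ) : ℂ) *
    ((whitingA M a ω * ((r - rPlus M a : ℝ) : ℂ)) * whitingAmplitude M a ω m R r) with hgN₃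
  have hnear_facts : ∀ {w : ℝ → ℂ} {Bw : ℝ}, Continuous w →
      (∀ r, rPlus M a < r → r ≤ rPlus M a + ε → ‖w r‖ ≤ Bw) → 0 ≤ Bw →
      ContinuousOn (fun r => ((χ r : ℝ) : ℂ) * (w r * whitingAmplitude M a ω m R r)) (Ioi (rPlus M a)) ∧
      (∀ r, rPlus M a < r → ‖((χ r : ℝ) : ℂ) * (w r * whitingAmplitude M a ω m R r)‖ ≤
        Bw * (CR * (1 + rPlus M a + ε) ^ kR)) ∧
      (∀ r, rPlus M a + ε ≤ r → ((χ r : ℝ) : ℂ) * (w r * whitingAmplitude M a ω m R r) = 0) := by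
    intro w Bw hw hwb hBw
    refine ⟨hχc.mul (hw.continuousOn.mul hΦc), fun r hr => ?_, fun r hr => ?_⟩
    · rcases lt_or_ge r q₁ with h | h
      · have hrε : r ≤ rPlus M a + ε := by rw [hq₁] at h; linarith
        rw [norm_mul, norm_mul, Complex.norm_real, Real.norm_eq_abs]
        calc |χ r| * (‖w r‖ * ‖whitingAmplitude M a ω m R r‖) ≤
            1 * (Bw * (CR * (1 + rPlus M a + ε) ^ kR)) :=
              mul_le_mul (hχabs r) (mul_le_mul (hwb r hr hrε) (hΦbε r hr hrε) (norm_nonneg _) hBw)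
                (by positivity) zero_le_one
          _ = _ := one_mul _
      · rw [hχ0 r h, Complex.ofReal_zero, zero_mul, norm_zero]
        exact mul_nonneg hBw hPε
    · rw [hχ0 r (by rw [hq₁]; linarith), Complex.ofReal_zero, zero_mul]
  have hwj : ∀ j : ℕ, (Continuous fun r => πw r ^ j) ∧
      (∀ r, rPlus M a < r → r ≤ rPlus M a + ε → ‖πw r ^ j‖ ≤ (‖whitingA M a ω‖ * (rPlus M a + ε)) ^ j) :=
    fun j => ⟨hπw_cont.pow j, fun r hr hrε => by
      rw [norm_pow]; exact pow_le_pow_left₀ (norm_nonneg _) (hπw_b r hr hrε) j⟩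
  have hAε : 0 ≤ ‖whitingA M a ω‖ * (rPlus M a + ε) := mul_nonneg (norm_nonneg _) (by linarith)
  obtain ⟨hg0c, hg0b, hg0z⟩ := hnear_facts (hwj 0).1 (hwj 0).2 (pow_nonneg hAε 0)
  obtain ⟨hg1c, hg1b, hg1z⟩ := hnear_facts (hwj 1).1 (hwj 1).2 (pow_nonneg hAε 1)
  obtain ⟨hg2c, hg2b, hg2z⟩ := hnear_facts (hwj 2).1 (hwj 2).2 (pow_nonneg hAε 2)
  have hw3 : ∀ r, rPlus M a < r → r ≤ rPlus M a + ε →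
      ‖whitingA M a ω * ((r - rPlus M a : ℝ) : ℂ)‖ ≤ ‖whitingA M a ω‖ * ε := by
    intro r hr hrε
    rw [norm_mul, Complex.norm_real, Real.norm_eq_abs, abs_of_nonneg (by linarith)]
    exact mul_le_mul_of_nonneg_left (by linarith) (norm_nonneg _)
  obtain ⟨hg3c, hg3b, hg3z⟩ := hnear_facts (w := fun r => whitingA M a ω * ((r - rPlus M a : ℝ) : ℂ))
    (continuous_const.mul (Complex.continuous_ofReal.comp (continuous_id.sub continuous_const))) hw3
    (mul_nonneg (norm_nonneg _) hε.le)
  -- near transforms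
  set N : ℕ → ℝ → ℝ → ℂ := fun j x y => whitingTransform M a ω (gNf j) ((x : ℂ) + I * y) with hN
  -- the derivative chain of the near transforms (any `y`)
  have hNd : ∀ j y x, HasDerivAt (fun x => N j x y) (N (j + 1) x y) x := by
    intro j y x
    have key : ∀ {gj : ℝ → ℂ} {Cg : ℝ}, ContinuousOn gj (Ioi (rPlus M a)) →
        (∀ r, rPlus M a < r → ‖gj r‖ ≤ Cg) → (∀ r, rPlus M a + ε ≤ r → gj r = 0) →
        HasDerivAt (fun x : ℝ => whitingTransform M a ω gj ((x : ℂ) + I * y))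
          (whitingTransform M a ω (fun r => whitingA M a ω * ((r - rMinus M a : ℝ) : ℂ) * gj r)
            ((x : ℂ) + I * y)) x :=
      fun hc hb hz => nearAmp_hasDerivAt_x hM ha ω hε hc hb hz y x
    have e : ∀ j, (fun r => whitingA M a ω * ((r - rMinus M a : ℝ) : ℂ) * gNf j r) = gNf (j + 1) := by
      intro j; funext r; simp only [hgNf, hπw]; ring
    rcases j with _ | _ | _ | j
    · have h := key hg0c hg0b hg0z; rw [e 0] at h; exact h
    · have h := key hg1c hg1b hg1z; rw [e 1] at h; exact h
    · have h := key hg2c hg2b hg2z; rw [e 2] at h; exact h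
    · -- higher `j`: general bound with `Bw = (‖A‖(r₊+ε))^(j+3)`
      obtain ⟨hc, hb, hz⟩ := hnear_facts (hwj (j + 3)).1 (hwj (j + 3)).2 (pow_nonneg hAε _)
      have h := key hc hb hz; rw [e (j + 3)] at h; exact h
  -- continuity in `y` of the near transforms
  have hNy : ∀ j, j ≤ 2 → ∀ x, Continuous fun y : ℝ => N j x y := by
    intro j hj x
    rcases j with _ | _ | _ | j
    · exact nearAmp_continuous_y hM ha ω hε hg0c hg0b hg0z x
    · exact nearAmp_continuous_y hM ha ω hε hg1c hg1b hg1z x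
    · exact nearAmp_continuous_y hM ha ω hε hg2c hg2b hg2z x
    · omega
  -- identification of the far derivatives at `y = 0`
  have hFarD₀ : ∀ x, rPlus M a < x → FarD₀ x 0 = Far₁ x 0 := by
    intro x hx
    have h := eq_zero_of_continuousWithinAt_side (g := fun y => FarD₀ x y - Far₁ x y) hω
      ((hFy₀ x hx).2.sub (hFy₁ x hx).1) fun y hy => by
        rw [hFa'₀ x y hy, hFa₁ x y hy]
        unfold whitingTransform
        rw [sub_eq_zero]
        refine integral_congr_ae (ae_of_all _ fun r => ?_)
        simp only [hπw]; ring
    exact sub_eq_zero.1 h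
  have hFarD₁ : ∀ x, rPlus M a < x → FarD₁ x 0 = Far₂ x 0 := by
    intro x hx
    have h := eq_zero_of_continuousWithinAt_side (g := fun y => FarD₁ x y - Far₂ x y) hω
      ((hFy₁ x hx).2.sub (hFy₂ x hx).1) fun y hy => by
        rw [hFa'₁ x y hy, hFa₂ x y hy]
        unfold whitingTransform
        rw [sub_eq_zero]
        refine integral_congr_ae (ae_of_all _ fun r => ?_)
        simp only [hπw]; ring
    exact sub_eq_zero.1 h
  -- the real-axis functions
  refine ⟨fun x => N 0 x 0 + Far₀ x 0, fun x => N 1 x 0 + Far₁ x 0, fun x => N 2 x 0 + Far₂ x 0,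
    fun x hx => ?_, fun x hx => ?_, fun x hx => ?_, ?_, ?_, ?_⟩
  · -- `G₀' = G₁`
    have h1 := hNd 0 0 x
    have h2 := hFd₀ x hx
    rw [hFarD₀ x hx] at h2
    exact h1.add h2
  · -- `G₁' = G₂`
    have h1 := hNd 1 0 x
    have h2 := hFd₁ x hx
    rw [hFarD₁ x hx] at h2
    exact h1.add h2
  · -- the tilde equation at `y = 0`
    obtain ⟨hPtc, hQtc⟩ := continuous_heunPt_heunQt M a s ω m lam
    have hz : Continuous fun y : ℝ => (x : ℂ) + I * y :=
      continuous_const.add (continuous_const.mul Complex.continuous_ofReal)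
    -- the three integrals of Lemma 3.12 split as near + far
    have hsplit : ∀ (j : ℕ) (Farj : ℝ → ℝ → ℂ), j ≤ 2 →
        (∀ x y, 0 < ω * y → Farj x y = whitingTransform M a ω
          (fun r => ((ρ r : ℝ) : ℂ) * πw r ^ j * whitingAmplitude M a ω m R r) ((x : ℂ) + I * y)) →
        ∀ y, 0 < ω * y →
          (∫ r in Ioi (rPlus M a), whitingKernel M a ω ((x : ℂ) + I * y) r *
            (whitingA M a ω * ((r - rMinus M a : ℝ) : ℂ)) ^ j * whitingAmplitude M a ω m R r) =
          N j x y + Farj x y := by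
      intro j Farj hj hFarj y hy
      have hnearI : IntegrableOn (fun r => whitingKernel M a ω ((x : ℂ) + I * y) r * gNf j r)
          (Ioi (rPlus M a)) := by
        rcases j with _ | _ | _ | j
        · exact nearAmp_integrableOn hε hg0c hg0b hg0z (continuous_whitingKernel_r M a ω _)
        · exact nearAmp_integrableOn hε hg1c hg1b hg1z (continuous_whitingKernel_r M a ω _)
        · exact nearAmp_integrableOn hε hg2c hg2b hg2z (continuous_whitingKernel_r M a ω _)
        · omega
      have htot := integrableOn_whitingKernel_mul hM ha hy x j hΦc hΦb
      have hfarI : IntegrableOn (fun r => whitingKernel M a ω ((x : ℂ) + I * y) r *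
          (((ρ r : ℝ) : ℂ) * πw r ^ j * whitingAmplitude M a ω m R r)) (Ioi (rPlus M a)) := by
        refine (htot.sub hnearI).congr_fun (fun r _ => ?_) measurableSet_Ioi
        simp only [hgNf, hπw, Pi.sub_apply]
        have := hχρ r
        linear_combination (-(whitingKernel M a ω ((x : ℂ) + I * y) r *
          (whitingA M a ω * ((r - rMinus M a : ℝ) : ℂ)) ^ j * whitingAmplitude M a ω m R r)) * this
      rw [hFarj x y hy]
      simp only [hN]
      unfold whitingTransform
      rw [← integral_add hnearI hfarI]
      refine integral_congr_ae (ae_of_all _ fun r => ?_)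
      simp only [hgNf, hπw]
      have := hχρ r
      linear_combination (-(whitingKernel M a ω ((x : ℂ) + I * y) r *
        (whitingA M a ω * ((r - rMinus M a : ℝ) : ℂ)) ^ j * whitingAmplitude M a ω m R r)) * this
    have key : ∀ y, 0 < ω * y →
        (((x : ℂ) + I * y) - rPlus M a) * (((x : ℂ) + I * y) - rMinus M a) * (N 2 x y + Far₂ x y) +
          heunPt M a s ω m ((x : ℂ) + I * y) * (N 1 x y + Far₁ x y) +
          heunQt M a s ω m lam ((x : ℂ) + I * y) * (N 0 x y + Far₀ x y) = 0 := by
      intro y hy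
      have hT := whitingTransform_tildeEquation hM ha hs hω m lam hsol hH hI hy x
      rw [hsplit 2 Far₂ le_rfl hFa₂ y hy, hsplit 1 Far₁ (by norm_num) hFa₁ y hy,
        hsplit 0 Far₀ (by norm_num) hFa₀ y hy] at hT
      exact hT
    have hcont : ContinuousWithinAt (fun y : ℝ =>
        (((x : ℂ) + I * y) - rPlus M a) * (((x : ℂ) + I * y) - rMinus M a) * (N 2 x y + Far₂ x y) +
          heunPt M a s ω m ((x : ℂ) + I * y) * (N 1 x y + Far₁ x y) +
          heunQt M a s ω m lam ((x : ℂ) + I * y) * (N 0 x y + Far₀ x y)) {y | 0 ≤ ω * y} 0 := by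
      refine ContinuousWithinAt.add (ContinuousWithinAt.add ?_ ?_) ?_
      · exact ((hz.sub continuous_const).mul (hz.sub continuous_const)).continuousWithinAt.mul
          ((hNy 2 le_rfl x).continuousWithinAt.add (hFy₂ x hx).1)
      · exact (hPtc.comp hz).continuousWithinAt.mul
          ((hNy 1 (by norm_num) x).continuousWithinAt.add (hFy₁ x hx).1)
      · exact (hQtc.comp hz).continuousWithinAt.mul
          ((hNy 0 (by norm_num) x).continuousWithinAt.add (hFy₀ x hx).1)
    have hE0 := eq_zero_of_continuousWithinAt_side hω hcont key
    have hz0 : (x : ℂ) + I * ((0 : ℝ) : ℂ) = x := by simp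
    have ePt : heunPt M a s ω m ((x : ℂ) + I * ((0 : ℝ) : ℂ)) = heunPt M a s ω m x := by rw [hz0]
    have eQt : heunQt M a s ω m lam ((x : ℂ) + I * ((0 : ℝ) : ℂ)) = heunQt M a s ω m lam x := by rw [hz0]
    have eΔ : (((x : ℂ) + I * ((0 : ℝ) : ℂ)) - rPlus M a) * (((x : ℂ) + I * ((0 : ℝ) : ℂ)) - rMinus M a) =
        (delta M a x : ℂ) := by
      rw [hz0, delta_eq_mul ha.le]; push_cast; ring
    rw [ePt, eQt, eΔ] at hE0
    exact hE0
  · -- boundedness near `r₊`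
    obtain ⟨BF₀, hBF₀⟩ := (isCompact_Icc (a := rPlus M a) (b := rPlus M a + 1)).exists_bound_of_continuousOn
      (hFx₀.mono Icc_subset_Ici_self)
    obtain ⟨BF₁, hBF₁⟩ := (isCompact_Icc (a := rPlus M a) (b := rPlus M a + 1)).exists_bound_of_continuousOn
      (hFx₁.mono Icc_subset_Ici_self)
    have hN0b := fun x => nearAmp_norm_le ha ω hε hg0b hg0z x
    have hN1b := fun x => nearAmp_norm_le ha ω hε hg1b hg1z x
    refine ⟨1, max ((‖whitingA M a ω‖ * (rPlus M a + ε)) ^ 0 * (CR * (1 + rPlus M a + ε) ^ kR) * ε + BF₀)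
      ((‖whitingA M a ω‖ * (rPlus M a + ε)) ^ 1 * (CR * (1 + rPlus M a + ε) ^ kR) * ε + BF₁), one_pos,
      fun x hx => ⟨?_, ?_⟩⟩
    · calc ‖N 0 x 0 + Far₀ x 0‖ ≤ ‖N 0 x 0‖ + ‖Far₀ x 0‖ := norm_add_le _ _
        _ ≤ _ := (add_le_add (hN0b x) (hBF₀ x ⟨hx.1.le, hx.2.le⟩)).trans (le_max_left _ _)
    · calc ‖N 1 x 0 + Far₁ x 0‖ ≤ ‖N 1 x 0‖ + ‖Far₁ x 0‖ := norm_add_le _ _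
        _ ≤ _ := (add_le_add (hN1b x) (hBF₁ x ⟨hx.1.le, hx.2.le⟩)).trans (le_max_right _ _)
  · -- decay
    show ∃ X C : ℝ, ∀ x, X ≤ x → ‖N 0 x 0 + Far₀ x 0‖ ≤ C * x ^ (s - 1) ∧
      ‖N 1 x 0 + Far₁ x 0‖ ≤ C * x ^ (s - 1) ∧
      ‖N 1 x 0 + Far₁ x 0 - 2 * I * ω * (N 0 x 0 + Far₀ x 0)‖ ≤ C * x ^ (s - 2)
    -- endpoint representations and Erdélyi bounds for the near parts
    set β : ℂ := 2 * horizonExponent M a ω m - s with hβ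
    have hβre : β.re = -s := by
      simp [hβ, Complex.sub_re, Complex.mul_re, horizonExponent_re M a ω m]
    obtain ⟨h₀, hh₀c, hh₀T, -, hrepr₀⟩ := exists_endpoint_repr hM ha ω m hε hεd hεp hf (β₀ := β)
      hfac hχs hχ1 (fun r hr => hχ0 r hr) (hπw_cd.pow 0) 0 (gN := gNf 0)
      (fun r => by simp only [hgNf, pow_zero, one_mul])
    obtain ⟨h₁, hh₁c, hh₁T, -, hrepr₁⟩ := exists_endpoint_repr hM ha ω m hε hεd hεp hf (β₀ := β)
      hfac hχs hχ1 (fun r hr => hχ0 r hr) (hπw_cd.pow 1) 0 (gN := gNf 1)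
      (fun r => by simp only [hgNf, pow_zero, one_mul])
    obtain ⟨h₃, hh₃c, hh₃T, -, hrepr₃⟩ := exists_endpoint_repr hM ha ω m hε hεd hεp hf (β₀ := β)
      hfac hχs hχ1 (fun r hr => hχ0 r hr) (contDiff_const (c := whitingA M a ω)) 1 (gN := gN₃)
      (fun r => by simp only [hgN₃, pow_one]; ring)
    have hT0 : (0 : ℝ) ≤ 2 * ε / 3 := by positivity
    obtain ⟨Ce₀, hCe₀⟩ := erdelyi_upper_bound (β := β + ((0 : ℕ) : ℂ)) (by simp [hβre]; linarith)
      hh₀c hT0 hh₀T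
    obtain ⟨Ce₁, hCe₁⟩ := erdelyi_upper_bound (β := β + ((0 : ℕ) : ℂ)) (by simp [hβre]; linarith)
      hh₁c hT0 hh₁T
    obtain ⟨Ce₃, hCe₃⟩ := erdelyi_upper_bound (β := β + ((1 : ℕ) : ℂ)) (by simp [hβre]; linarith)
      hh₃c hT0 hh₃T
    have e0 : (-(β + ((0 : ℕ) : ℂ)).re - 1) = s - 1 := by simp [hβre]
    have e1 : (-(β + ((1 : ℕ) : ℂ)).re - 1) = s - 2 := by simp [hβre]; ring
    rw [e0] at hCe₀ hCe₁
    rw [e1] at hCe₃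
    -- the near transforms on the real axis as endpoint integrals
    set νf : ℝ → ℝ := fun x => 2 * ω * (x - rMinus M a) / (rPlus M a - rMinus M a) with hνf
    have hN0r := fun x => nearAmp_repr_realAxis ha ω (g := gNf 0) hrepr₀ x
    have hN1r := fun x => nearAmp_repr_realAxis ha ω (g := gNf 1) hrepr₁ x
    have hN3r := fun x => nearAmp_repr_realAxis ha ω (g := gN₃) hrepr₃ x
    -- `N₁ − 2iω N₀` is the transform of `χ A(r−r₊) Φ`
    have hN3 : ∀ x, N 1 x 0 - 2 * I * ω * N 0 x 0 =
        whitingTransform M a ω gN₃ ((x : ℂ) + I * ((0 : ℝ) : ℂ)) := by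
      intro x
      have hI1 := nearAmp_integrableOn hε hg1c hg1b hg1z
        (continuous_whitingKernel_r M a ω ((x : ℂ) + I * ((0 : ℝ) : ℂ)))
      have hI0 := nearAmp_integrableOn hε hg0c hg0b hg0z
        (continuous_whitingKernel_r M a ω ((x : ℂ) + I * ((0 : ℝ) : ℂ)))
      simp only [hN]
      unfold whitingTransform
      rw [← integral_const_mul, ← integral_sub hI1 (hI0.const_mul _)]
      refine integral_congr_ae (ae_of_all _ fun r => ?_)
      simp only [hgN₃, hπw]
      rw [← hAd]
      push_cast
      ring
    -- sizes of `ν(x) = 2ω(x−r₋)/(r₊−r₋)` for large `x`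
    have hν_abs : ∀ x, rMinus M a ≤ x →
        |νf x| = 2 * |ω| / (rPlus M a - rMinus M a) * (x - rMinus M a) := by
      intro x hx
      simp only [hνf]
      rw [abs_div, abs_of_pos hgap, abs_mul, abs_mul, abs_two, abs_of_nonneg (sub_nonneg.2 hx)]
      ring
    set X : ℝ := max (max XF₀ XF₁) (max (2 * rPlus M a)
      (max 1 (rMinus M a + (rPlus M a - rMinus M a) / (2 * |ω|)))) with hX
    have hXF₀ : XF₀ ≤ X := (le_max_left _ _).trans (le_max_left _ _)
    have hXF₁ : XF₁ ≤ X := (le_max_right _ _).trans (le_max_left _ _)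
    have hX2 : 2 * rPlus M a ≤ X := (le_max_left _ _).trans (le_max_right _ _)
    have hX1 : 1 ≤ X := ((le_max_left _ _).trans (le_max_right _ _)).trans (le_max_right _ _)
    have hXν : rMinus M a + (rPlus M a - rMinus M a) / (2 * |ω|) ≤ X :=
      ((le_max_right _ _).trans (le_max_right _ _)).trans (le_max_right _ _)
    set κ₁ : ℝ := (|ω| / (rPlus M a - rMinus M a)) ^ (s - 1) with hκ₁
    set κ₂ : ℝ := (|ω| / (rPlus M a - rMinus M a)) ^ (s - 2) with hκ₂
    have hωd : 0 < |ω| / (rPlus M a - rMinus M a) := div_pos hωpos hgap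
    have hfacts : ∀ x, X ≤ x → rPlus M a < x ∧ 0 < x ∧ 1 ≤ x ∧ 1 ≤ |νf x| ∧
        |νf x| ^ (s - 1) ≤ κ₁ * x ^ (s - 1) ∧ |νf x| ^ (s - 2) ≤ κ₂ * x ^ (s - 2) ∧
        x ^ (-(n₀ : ℝ)) ≤ x ^ (s - 1) ∧ x ^ (-(n₀ : ℝ)) ≤ x ^ (s - 2) := by
      intro x hx
      have hx2 : 2 * rPlus M a ≤ x := hX2.trans hx
      have hx1 : 1 ≤ x := hX1.trans hx
      have hxp : rPlus M a < x := by linarith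
      have hx0 : 0 < x := by linarith
      have hxm : rMinus M a ≤ x := (rMinus_le_rPlus M a).trans hxp.le
      have hνa := hν_abs x hxm
      have hν1 : 1 ≤ |νf x| := by
        rw [hνa]
        have h1 : (rPlus M a - rMinus M a) / (2 * |ω|) ≤ x - rMinus M a := by linarith [hXν.trans hx]
        have h2 : 2 * |ω| / (rPlus M a - rMinus M a) * ((rPlus M a - rMinus M a) / (2 * |ω|)) = 1 := by
          field_simp
        calc (1 : ℝ) = _ := h2.symm
          _ ≤ _ := mul_le_mul_of_nonneg_left h1 (by positivity)
      have hνlow : |ω| / (rPlus M a - rMinus M a) * x ≤ |νf x| := by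
        rw [hνa]
        have : x / 2 ≤ x - rMinus M a := by linarith [rMinus_le_rPlus M a]
        calc |ω| / (rPlus M a - rMinus M a) * x =
            2 * |ω| / (rPlus M a - rMinus M a) * (x / 2) := by ring
          _ ≤ 2 * |ω| / (rPlus M a - rMinus M a) * (x - rMinus M a) :=
              mul_le_mul_of_nonneg_left this (by positivity)
      have hpos : 0 < |ω| / (rPlus M a - rMinus M a) * x := mul_pos hωd hx0
      have hp1 : |νf x| ^ (s - 1) ≤ κ₁ * x ^ (s - 1) := by
        calc |νf x| ^ (s - 1) ≤ (|ω| / (rPlus M a - rMinus M a) * x) ^ (s - 1) :=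
              Real.rpow_le_rpow_of_nonpos hpos hνlow (by linarith)
          _ = κ₁ * x ^ (s - 1) := by rw [hκ₁, Real.mul_rpow hωd.le hx0.le]
      have hp2 : |νf x| ^ (s - 2) ≤ κ₂ * x ^ (s - 2) := by
        calc |νf x| ^ (s - 2) ≤ (|ω| / (rPlus M a - rMinus M a) * x) ^ (s - 2) :=
              Real.rpow_le_rpow_of_nonpos hpos hνlow (by linarith)
          _ = κ₂ * x ^ (s - 2) := by rw [hκ₂, Real.mul_rpow hωd.le hx0.le]
      exact ⟨hxp, hx0, hx1, hν1, hp1, hp2,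
        Real.rpow_le_rpow_of_exponent_le hx1 (by linarith),
        Real.rpow_le_rpow_of_exponent_le hx1 (by linarith)⟩
    have hκ₁0 : 0 ≤ κ₁ := Real.rpow_nonneg hωd.le _
    have hκ₂0 : 0 ≤ κ₂ := Real.rpow_nonneg hωd.le _
    -- norms of the near transforms
    have hnorm_near : ∀ {g : ℝ → ℂ} {hh : ℝ → ℂ} {β' : ℂ} (x : ℝ),
        whitingTransform M a ω g ((x : ℂ) + I * ((0 : ℝ) : ℂ)) =
          Complex.exp (I * ((2 * ω * (x - rMinus M a) / (rPlus M a - rMinus M a) : ℝ) : ℂ) *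
              ((rPlus M a - rMinus M a : ℝ) : ℂ)) *
            ∫ t in Ioi (0 : ℝ), Complex.exp (I * ((2 * ω * (x - rMinus M a) /
              (rPlus M a - rMinus M a) : ℝ) : ℂ) * t) * (t : ℂ) ^ β' * hh t →
        ‖whitingTransform M a ω g ((x : ℂ) + I * ((0 : ℝ) : ℂ))‖ =
          ‖∫ t in Ioi (0 : ℝ), Complex.exp (I * (νf x) * t) * (t : ℂ) ^ β' * hh t‖ := by
      intro g hh β' x hrepr
      rw [hrepr, norm_mul, norm_cexp_I_mul_ofReal_mul_ofReal, one_mul]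
    set C₀ : ℝ := |Ce₀| * κ₁ + |CF₀| with hC₀
    set C₁ : ℝ := |Ce₁| * κ₁ + |CF₁| with hC₁
    set C₂ : ℝ := |Ce₃| * κ₂ + (|CF₁| + 2 * |ω| * |CF₀|) with hC₂
    refine ⟨X, max C₀ (max C₁ C₂), fun x hx => ?_⟩
    obtain ⟨hxp, hx0, hx1, hν1, hp1, hp2, hn1, hn2⟩ := hfacts x hx
    have hxs1 : 0 ≤ x ^ (s - 1) := Real.rpow_nonneg hx0.le _
    have hxs2 : 0 ≤ x ^ (s - 2) := Real.rpow_nonneg hx0.le _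
    -- the three near bounds
    have hb0 : ‖N 0 x 0‖ ≤ |Ce₀| * κ₁ * x ^ (s - 1) := by
      have e := hnorm_near (g := gNf 0) x (hN0r x)
      simp only [hN]
      rw [e]
      calc _ ≤ Ce₀ * |νf x| ^ (s - 1) := hCe₀ (νf x) hν1
        _ ≤ |Ce₀| * |νf x| ^ (s - 1) :=
            mul_le_mul_of_nonneg_right (le_abs_self _) (Real.rpow_nonneg (abs_nonneg _) _)
        _ ≤ |Ce₀| * (κ₁ * x ^ (s - 1)) := mul_le_mul_of_nonneg_left hp1 (abs_nonneg _)
        _ = _ := by ring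
    have hb1 : ‖N 1 x 0‖ ≤ |Ce₁| * κ₁ * x ^ (s - 1) := by
      have e := hnorm_near (g := gNf 1) x (hN1r x)
      simp only [hN]
      rw [e]
      calc _ ≤ Ce₁ * |νf x| ^ (s - 1) := hCe₁ (νf x) hν1
        _ ≤ |Ce₁| * |νf x| ^ (s - 1) :=
            mul_le_mul_of_nonneg_right (le_abs_self _) (Real.rpow_nonneg (abs_nonneg _) _)
        _ ≤ |Ce₁| * (κ₁ * x ^ (s - 1)) := mul_le_mul_of_nonneg_left hp1 (abs_nonneg _)
        _ = _ := by ring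
    have hb3 : ‖whitingTransform M a ω gN₃ ((x : ℂ) + I * ((0 : ℝ) : ℂ))‖ ≤ |Ce₃| * κ₂ * x ^ (s - 2) := by
      rw [hnorm_near (g := gN₃) x (hN3r x)]
      calc _ ≤ Ce₃ * |νf x| ^ (s - 2) := hCe₃ (νf x) hν1
        _ ≤ |Ce₃| * |νf x| ^ (s - 2) :=
            mul_le_mul_of_nonneg_right (le_abs_self _) (Real.rpow_nonneg (abs_nonneg _) _)
        _ ≤ |Ce₃| * (κ₂ * x ^ (s - 2)) := mul_le_mul_of_nonneg_left hp2 (abs_nonneg _)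
        _ = _ := by ring
    -- the far bounds
    have hf0 : ‖Far₀ x 0‖ ≤ |CF₀| * x ^ (-(n₀ : ℝ)) :=
      (hFdec₀ x (hXF₀.trans hx)).trans (mul_le_mul_of_nonneg_right (le_abs_self _) (Real.rpow_nonneg hx0.le _))
    have hf1 : ‖Far₁ x 0‖ ≤ |CF₁| * x ^ (-(n₀ : ℝ)) :=
      (hFdec₁ x (hXF₁.trans hx)).trans (mul_le_mul_of_nonneg_right (le_abs_self _) (Real.rpow_nonneg hx0.le _))
    have hCm₀ : C₀ ≤ max C₀ (max C₁ C₂) := le_max_left _ _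
    have hCm₁ : C₁ ≤ max C₀ (max C₁ C₂) := (le_max_left _ _).trans (le_max_right _ _)
    have hCm₂ : C₂ ≤ max C₀ (max C₁ C₂) := (le_max_right _ _).trans (le_max_right _ _)
    refine ⟨?_, ?_, ?_⟩
    · calc ‖N 0 x 0 + Far₀ x 0‖ ≤ ‖N 0 x 0‖ + ‖Far₀ x 0‖ := norm_add_le _ _
        _ ≤ |Ce₀| * κ₁ * x ^ (s - 1) + |CF₀| * x ^ (s - 1) :=
            add_le_add hb0 (hf0.trans (mul_le_mul_of_nonneg_left hn1 (abs_nonneg _)))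
        _ = C₀ * x ^ (s - 1) := by rw [hC₀]; ring
        _ ≤ max C₀ (max C₁ C₂) * x ^ (s - 1) := mul_le_mul_of_nonneg_right hCm₀ hxs1
    · calc ‖N 1 x 0 + Far₁ x 0‖ ≤ ‖N 1 x 0‖ + ‖Far₁ x 0‖ := norm_add_le _ _
        _ ≤ |Ce₁| * κ₁ * x ^ (s - 1) + |CF₁| * x ^ (s - 1) :=
            add_le_add hb1 (hf1.trans (mul_le_mul_of_nonneg_left hn1 (abs_nonneg _)))
        _ = C₁ * x ^ (s - 1) := by rw [hC₁]; ring
        _ ≤ max C₀ (max C₁ C₂) * x ^ (s - 1) := mul_le_mul_of_nonneg_right hCm₁ hxs1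
    · have hsplit : N 1 x 0 + Far₁ x 0 - 2 * I * ω * (N 0 x 0 + Far₀ x 0) =
          (N 1 x 0 - 2 * I * ω * N 0 x 0) + (Far₁ x 0 - 2 * I * ω * Far₀ x 0) := by ring
      rw [hsplit, hN3 x]
      have hω2 : ‖(2 * I * ω : ℂ)‖ = 2 * |ω| := by
        rw [norm_mul, norm_mul, Complex.norm_I, Complex.norm_real, Real.norm_eq_abs]
        norm_num
      calc ‖whitingTransform M a ω gN₃ ((x : ℂ) + I * ((0 : ℝ) : ℂ)) + (Far₁ x 0 - 2 * I * ω * Far₀ x 0)‖ ≤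
          ‖whitingTransform M a ω gN₃ ((x : ℂ) + I * ((0 : ℝ) : ℂ))‖ + (‖Far₁ x 0‖ + ‖(2 * I * ω : ℂ)‖ * ‖Far₀ x 0‖) := by
            refine (norm_add_le _ _).trans (add_le_add le_rfl ?_)
            refine (norm_sub_le _ _).trans (add_le_add le_rfl ?_)
            rw [norm_mul]
        _ ≤ |Ce₃| * κ₂ * x ^ (s - 2) + (|CF₁| * x ^ (s - 2) + 2 * |ω| * (|CF₀| * x ^ (s - 2))) := by
            rw [hω2]
            exact add_le_add hb3 (add_le_add (hf1.trans (mul_le_mul_of_nonneg_left hn2 (abs_nonneg _)))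
              (mul_le_mul_of_nonneg_left (hf0.trans (mul_le_mul_of_nonneg_left hn2 (abs_nonneg _)))
                (by positivity)))
        _ = C₂ * x ^ (s - 2) := by rw [hC₂]; ring
        _ ≤ max C₀ (max C₁ C₂) * x ^ (s - 2) := mul_le_mul_of_nonneg_right hCm₂ hxs2
  · -- injectivity link
    intro hG0
    have hG0' : ∀ x, rPlus M a < x → N 0 x 0 = -Far₀ x 0 := fun x hx =>
      eq_neg_of_add_eq_zero_left (hG0 x hx)
    -- the endpoint representation of the near part
    set β : ℂ := 2 * horizonExponent M a ω m - s with hβ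
    have hβre : β.re = -s := by
      simp [hβ, Complex.sub_re, Complex.mul_re, horizonExponent_re M a ω m]
    obtain ⟨h₀, hh₀c, hh₀T, hh₀0, hrepr₀⟩ := exists_endpoint_repr hM ha ω m hε hεd hεp hf (β₀ := β)
      hfac hχs hχ1 (fun r hr => hχ0 r hr) (hπw_cd.pow 0) 0 (gN := gNf 0)
      (fun r => by simp only [hgNf, pow_zero, one_mul])
    have hN0r := fun x => nearAmp_repr_realAxis ha ω (g := gNf 0) hrepr₀ x
    -- `f(r₊) = 0`
    have hf0 : f (rPlus M a) = 0 := by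
      by_contra hne
      have hh00 : h₀ 0 ≠ 0 := by
        rw [hh₀0]
        simp only [pow_zero, one_mul]
        refine mul_ne_zero (mul_ne_zero ?_ (Complex.exp_ne_zero _)) hne
        intro h
        have := (Complex.cpow_eq_zero_iff _ _).1 h
        exact absurd this.1 (by exact_mod_cast hgap.ne')
      obtain ⟨c, ν₀, hc, hlow⟩ := erdelyi_lower_bound (β := β + ((0 : ℕ) : ℂ))
        (by simp [hβre]; linarith) hh₀c (by positivity : (0 : ℝ) ≤ 2 * ε / 3) hh₀T hh00
      have e0 : (-(β + ((0 : ℕ) : ℂ)).re - 1) = s - 1 := by simp [hβre]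
      rw [e0] at hlow
      -- constants
      set κ : ℝ := (2 * |ω| / (rPlus M a - rMinus M a)) ^ (s - 1) with hκ
      have hωd2 : 0 < 2 * |ω| / (rPlus M a - rMinus M a) := by positivity
      have hκ0 : 0 < κ := Real.rpow_pos_of_pos hωd2 _
      set X' : ℝ := max XF₀ (max (2 * rPlus M a) (max 1
        (rMinus M a + (rPlus M a - rMinus M a) * |ν₀| / (2 * |ω|)))) with hX'
      set x₀ : ℝ := max X' (|CF₀| / (c * κ) + 1) with hx₀
      have hxX' : X' ≤ x₀ := le_max_left _ _
      have hxF : XF₀ ≤ x₀ := (le_max_left _ _).trans hxX'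
      have hx2 : 2 * rPlus M a ≤ x₀ := ((le_max_left _ _).trans (le_max_right _ _)).trans hxX'
      have hx1 : 1 ≤ x₀ := (((le_max_left _ _).trans (le_max_right _ _)).trans (le_max_right _ _)).trans hxX'
      have hxν : rMinus M a + (rPlus M a - rMinus M a) * |ν₀| / (2 * |ω|) ≤ x₀ :=
        (((le_max_right _ _).trans (le_max_right _ _)).trans (le_max_right _ _)).trans hxX'
      have hxbig : |CF₀| / (c * κ) + 1 ≤ x₀ := le_max_right _ _
      have hxp : rPlus M a < x₀ := by linarith
      have hx00 : 0 < x₀ := by linarith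
      have hxm : rMinus M a ≤ x₀ := (rMinus_le_rPlus M a).trans hxp.le
      -- `|ν(x₀)|`
      set ν : ℝ := 2 * ω * (x₀ - rMinus M a) / (rPlus M a - rMinus M a) with hν
      have hνa : |ν| = 2 * |ω| / (rPlus M a - rMinus M a) * (x₀ - rMinus M a) := by
        simp only [hν]
        rw [abs_div, abs_of_pos hgap, abs_mul, abs_mul, abs_two, abs_of_nonneg (sub_nonneg.2 hxm)]
        ring
      have hνν₀ : ν₀ ≤ |ν| := by
        rw [hνa]
        have h1 : (rPlus M a - rMinus M a) * |ν₀| / (2 * |ω|) ≤ x₀ - rMinus M a := by linarith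
        have h2 : 2 * |ω| / (rPlus M a - rMinus M a) * ((rPlus M a - rMinus M a) * |ν₀| / (2 * |ω|)) = |ν₀| := by
          field_simp
        calc ν₀ ≤ |ν₀| := le_abs_self _
          _ = _ := h2.symm
          _ ≤ _ := mul_le_mul_of_nonneg_left h1 hωd2.le
      have hνup : |ν| ≤ 2 * |ω| / (rPlus M a - rMinus M a) * x₀ := by
        rw [hνa]
        exact mul_le_mul_of_nonneg_left (by linarith) hωd2.le
      have hνpos : 0 < |ν| := by
        rw [hνa]; exact mul_pos hωd2 (by linarith)
      -- the chain of inequalities at `x₀`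
      have h1 : c * |ν| ^ (s - 1) ≤ ‖N 0 x₀ 0‖ := by
        have e : ‖N 0 x₀ 0‖ = ‖∫ t in Ioi (0 : ℝ), Complex.exp (I * ν * t) * (t : ℂ) ^ (β + ((0 : ℕ) : ℂ)) * h₀ t‖ := by
          simp only [hN]
          rw [hN0r x₀, norm_mul, norm_cexp_I_mul_ofReal_mul_ofReal, one_mul]
        rw [e]
        exact hlow ν hνν₀
      have h2 : ‖N 0 x₀ 0‖ ≤ |CF₀| * x₀ ^ (-(n₀ : ℝ)) := by
        rw [hG0' x₀ hxp, norm_neg]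
        exact (hFdec₀ x₀ hxF).trans (mul_le_mul_of_nonneg_right (le_abs_self _) (Real.rpow_nonneg hx00.le _))
      have h3 : x₀ ^ (-(n₀ : ℝ)) ≤ x₀ ^ (s - 2) := Real.rpow_le_rpow_of_exponent_le hx1 (by linarith)
      have h4 : κ * x₀ ^ (s - 1) ≤ |ν| ^ (s - 1) := by
        calc κ * x₀ ^ (s - 1) = (2 * |ω| / (rPlus M a - rMinus M a) * x₀) ^ (s - 1) := by
              rw [hκ, Real.mul_rpow hωd2.le hx00.le]
          _ ≤ |ν| ^ (s - 1) := Real.rpow_le_rpow_of_nonpos hνpos hνup (by linarith)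
      have h5 : x₀ ^ (s - 2) = x₀ ^ (s - 1) * x₀⁻¹ := by
        rw [show s - 2 = (s - 1) + (-1 : ℝ) by ring, Real.rpow_add hx00, Real.rpow_neg_one]
      have hP : 0 < x₀ ^ (s - 1) := Real.rpow_pos_of_pos hx00 _
      -- `c κ x₀^{s−1} ≤ |CF₀| x₀^{s−1} / x₀`
      have h6 : c * κ * x₀ ^ (s - 1) ≤ |CF₀| * x₀⁻¹ * x₀ ^ (s - 1) := by
        calc c * κ * x₀ ^ (s - 1) = c * (κ * x₀ ^ (s - 1)) := by ring
          _ ≤ c * |ν| ^ (s - 1) := mul_le_mul_of_nonneg_left h4 hc.le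
          _ ≤ |CF₀| * x₀ ^ (-(n₀ : ℝ)) := h1.trans h2
          _ ≤ |CF₀| * x₀ ^ (s - 2) := mul_le_mul_of_nonneg_left h3 (abs_nonneg _)
          _ = |CF₀| * x₀⁻¹ * x₀ ^ (s - 1) := by rw [h5]; ring
      have h7 : c * κ ≤ |CF₀| * x₀⁻¹ := le_of_mul_le_mul_right h6 hP
      have h8 : c * κ * x₀ ≤ |CF₀| := by
        calc c * κ * x₀ ≤ |CF₀| * x₀⁻¹ * x₀ := mul_le_mul_of_nonneg_right h7 hx00.le
          _ = |CF₀| := by field_simp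
      have hcκ : 0 < c * κ := mul_pos hc hκ0
      have h9 : x₀ ≤ |CF₀| / (c * κ) := by
        rw [le_div_iff₀ hcκ]; linarith
      linarith
    -- conclusion: `R (r−r₊)^{s−ξ} = f → f(r₊) = 0`
    have hfc : ContinuousAt f (rPlus M a) :=
      hf.continuousOn.continuousAt (isOpen_Ioo.mem_nhds ⟨by linarith, by linarith⟩)
    have h1 : Tendsto f (𝓝[>] rPlus M a) (𝓝 0) := by
      have := hfc.tendsto.mono_left (nhdsWithin_le_nhds (s := Ioi (rPlus M a)))
      rwa [hf0] at this
    refine h1.congr' ?_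
    filter_upwards [Ioo_mem_nhdsGT (show rPlus M a < rPlus M a + 2 * ε by linarith)] with r hr
    exact (hRf r hr).symm

end Costa2019

end Literature.Geometry.Lorentzian.Kerr

end
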